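import Summits.CriticalPhenomena.PercolationContinuityZ3.Theorems.PercNearOneGluingNoHeavyLowerTailSunflowerLiftRetention
import HarnessLib

/-!
# `NoHeavyLowerTail` (crux stmt-CriticalPhenomena-4575), abstract sunflower cubic: the retention conjecture `Retention3` CONTAINS
# restriction monotonicity (MZ)

Support file (seat `prim-ineq-prove-1` gen 28; `--supports stmt-CriticalPhenomena-4575`; companion of `…SunflowerLiftRetention` (p223551) and
`…SunflowerPartitionReduction` (p217435)).  Memo: run/shared/lean/prim/prim-ineq-prove-1/FINDING-LIFTCONE-prove1-g28.md §1.  Nothing is asserted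
about the crux; no `sorry`.

* `freeOn W` — the threshold-cell code vector of a sub-cube `W ⊆ α`: free (`4`) on `W`, absent (`0`) elsewhere; `inCell_freeOn_iff`: its cell is the
  set of ordered 3-partitions of `W`.
* `Sunflower.G_freeOn_eq_ZP : F.G (freeOn W) = F.ZP W ∅ ∅ ∅` — the sub-cube partition functional of `…SunflowerPartitionReduction` is a threshold cell.
* `restrictionMonotonicity_of_retention3 : Retention3 → RestrictionMonotonicity` — (MZ) `ZP W ∅ ∅ ∅ ≤ ZP (insert e W) ∅ ∅ ∅` is the case
  "all other codes free" of the one-coordinate retention conjecture (R3)/(MON); so the census of `Retention3` (all threshold cells) extends the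
  (MZ) census, and `partitionLemmaH_of_restrictionMonotonicity ∘ restrictionMonotonicity_of_retention3` is a second route to ★ from (R3) alone.
-/

namespace Summit.CriticalPhenomena.PercolationContinuityZ3.Theorems.SunflowerPartition

open Finset

variable {α : Type*} [Fintype α] [DecidableEq α]

/-! ## The sub-cube cell -/

/-- The code vector of a sub-cube `W`: free (`4`) on `W`, absent (`0`) elsewhere. [this work] -/
def freeOn (W : Finset α) (e : α) : Fin 8 := if e ∈ W then 4 else 0

/-- Code `0` allows only the pattern "in no copy". [this work] -/
theorem okPat_zero : ∀ b1 b2 b3 : Bool, okPat 0 (patOf b1 b2 b3) = true ↔ (b1 = false ∧ b2 = false ∧ b3 = false) := by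
  unfold okPat patOf; decide

/-- Membership in the cell of `freeOn W`: an ordered 3-partition of `W`. [this work] -/
theorem inCell_freeOn_iff (W x y z : Finset α) :
    inCell (freeOn W) x y z = true ↔ x ⊆ W ∧ y ⊆ W ∧ Disjoint x y ∧ z = W \ (x ∪ y) := by
  rw [inCell_iff]
  constructor
  · intro h
    have hpt : ∀ e, (e ∈ W → ((e ∈ x ∧ e ∉ y ∧ e ∉ z) ∨ (e ∉ x ∧ e ∈ y ∧ e ∉ z) ∨ (e ∉ x ∧ e ∉ y ∧ e ∈ z))) ∧
        (e ∉ W → (e ∉ x ∧ e ∉ y ∧ e ∉ z)) := by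
      intro e
      have he := h e
      unfold freeOn at he
      by_cases hw : e ∈ W
      · rw [if_pos hw] at he
        have := (okPat_four _ _ _).1 he
        simp only [decide_eq_true_eq, decide_eq_false_iff_not] at this
        exact ⟨fun _ => this, fun hn => absurd hw hn⟩
      · rw [if_neg hw] at he
        have := (okPat_zero _ _ _).1 he
        simp only [decide_eq_false_iff_not] at this
        exact ⟨fun hw' => absurd hw' hw, fun _ => this⟩
    refine ⟨fun e hex => ?_, fun e hey => ?_, disjoint_left.2 fun e hex hey => ?_, ?_⟩
    · by_contra hw; exact ((hpt e).2 hw).1 hex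
    · by_contra hw; exact ((hpt e).2 hw).2.1 hey
    · by_cases hw : e ∈ W
      · rcases (hpt e).1 hw with h1 | h1 | h1
        · exact h1.2.1 hey
        · exact h1.1 hex
        · exact h1.1 hex
      · exact ((hpt e).2 hw).1 hex
    · ext e
      simp only [mem_sdiff, mem_union, not_or]
      by_cases hw : e ∈ W
      · rcases (hpt e).1 hw with h1 | h1 | h1
        · exact ⟨fun hz => absurd hz h1.2.2, fun hh => absurd h1.1 hh.2.1⟩
        · exact ⟨fun hz => absurd hz h1.2.2, fun hh => absurd h1.2.1 hh.2.2⟩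
        · exact ⟨fun _ => ⟨hw, h1.1, h1.2.1⟩, fun _ => h1.2.2⟩
      · exact ⟨fun hz => absurd hz ((hpt e).2 hw).2.2, fun hh => absurd hh.1 hw⟩
  · rintro ⟨hx, hy, hd, rfl⟩ e
    unfold freeOn
    by_cases hw : e ∈ W
    · rw [if_pos hw, okPat_four]
      by_cases hex : e ∈ x
      · have hey : e ∉ y := disjoint_left.1 hd hex
        have hez : e ∉ W \ (x ∪ y) := fun h => (mem_sdiff.1 h).2 (mem_union.2 (Or.inl hex))
        exact Or.inl ⟨decide_eq_true hex, decide_eq_false hey, decide_eq_false hez⟩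
      · by_cases hey : e ∈ y
        · have hez : e ∉ W \ (x ∪ y) := fun h => (mem_sdiff.1 h).2 (mem_union.2 (Or.inr hey))
          exact Or.inr (Or.inl ⟨decide_eq_false hex, decide_eq_true hey, decide_eq_false hez⟩)
        · have hez : e ∈ W \ (x ∪ y) := mem_sdiff.2 ⟨hw, fun h => (mem_union.1 h).elim hex hey⟩
          exact Or.inr (Or.inr ⟨decide_eq_false hex, decide_eq_false hey, decide_eq_true hez⟩)
    · rw [if_neg hw, okPat_zero]
      have hex : e ∉ x := fun h => hw (hx h)
      have hey : e ∉ y := fun h => hw (hy h)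
      have hez : e ∉ W \ (x ∪ y) := fun h => hw (mem_sdiff.1 h).1
      exact ⟨decide_eq_false hex, decide_eq_false hey, decide_eq_false hez⟩

namespace Sunflower

variable (F : Sunflower α)

/-- **The sub-cube partition functional is the cell of `freeOn W`.** [this work] -/
theorem G_freeOn_eq_ZP (W : Finset α) : F.G (freeOn W) = F.ZP W ∅ ∅ ∅ := by
  unfold G ZP partsOf
  symm
  refine sum_nbij' (fun q => (q.1, q.2, W \ (q.1 ∪ q.2))) (fun t => (t.1, t.2.1)) ?_ ?_ ?_ ?_ ?_
  · intro q hq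
    rw [mem_filter, mem_product, mem_powerset, mem_powerset] at hq
    rw [mem_filter]
    exact ⟨mem_univ _, (inCell_freeOn_iff _ _ _ _).2 ⟨hq.1.1, hq.1.2, hq.2, rfl⟩⟩
  · intro t ht
    rw [mem_filter] at ht
    obtain ⟨hx, hy, hd, _⟩ := (inCell_freeOn_iff _ _ _ _).1 ht.2
    rw [mem_filter, mem_product, mem_powerset, mem_powerset]
    exact ⟨⟨hx, hy⟩, hd⟩
  · intro q _
    rfl
  · intro t ht
    rw [mem_filter] at ht
    have hz := ((inCell_freeOn_iff _ _ _ _).1 ht.2).2.2.2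
    ext <;> simp [hz]
  · intro q _
    simp only [empty_union]

omit [Fintype α] in
/-- Updating `freeOn (insert e W)` at `e ∉ W` to `0` gives `freeOn W`. [this work] -/
theorem freeOn_insert_update {W : Finset α} {e : α} :
    Function.update (freeOn (insert e W)) e (0 : Fin 8) = freeOn W ↔ e ∉ W := by
  constructor
  · intro h hw
    have := congrFun h e
    rw [Function.update_self] at this
    unfold freeOn at this
    rw [if_pos hw] at this
    exact absurd this (by decide)
  · intro he
    funext e'
    unfold freeOn
    by_cases h : e' = e
    · subst h; rw [Function.update_self, if_neg he]
    · rw [Function.update_of_ne h]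
      by_cases hw : e' ∈ W
      · rw [if_pos (mem_insert_of_mem hw), if_pos hw]
      · rw [if_neg (fun hh => (mem_insert.1 hh).elim h hw), if_neg hw]

end Sunflower

/-- **`Retention3` contains restriction monotonicity (MZ)**: the sub-cube functional `ZP W ∅ ∅ ∅` is the cell `freeOn W`, and adding the free
coordinate `e` is the case `k e = 4` of `Retention3`. [this work] -/
theorem restrictionMonotonicity_of_retention3 (h3 : Retention3) : RestrictionMonotonicity := by
  intro α _ _ F W e he
  rw [← F.G_freeOn_eq_ZP, ← F.G_freeOn_eq_ZP]
  have hk : freeOn (insert e W) e = 4 := by unfold freeOn; rw [if_pos (mem_insert_self e W)]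
  have := (h3 α F (freeOn (insert e W)) e).1 hk
  rwa [Sunflower.freeOn_insert_update.2 he] at this

/-- ★ from (R3) alone, via restriction monotonicity. [this work] -/
theorem partitionLemmaH_of_retention3 (h3 : Retention3) : PartitionLemmaH :=
  partitionLemmaH_of_restrictionMonotonicity (restrictionMonotonicity_of_retention3 h3)

end Summit.CriticalPhenomena.PercolationContinuityZ3.Theorems.SunflowerPartition
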